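import Summits.ResolutionOfSingularities.ResolutionOfSingularities.Theorems.PurelyInseparableDim4SpivakovskyMove
import Summits.ResolutionOfSingularities.ResolutionOfSingularities.Theorems.PurelyInseparableDim4SpivakovskyOneVertex
import HarnessLib

/-!
# [OURS · res-dim4-pi PR-9c, part 4] Spivakovsky's theorem: the strategy admits NO infinite play

Cell `res-dim4-pi` (D-0157 DOOR 2), brick **PR-9c / NEED-FACT «Spivakovsky 1983»** (desk WORD #25 (e); consortium:
`res-dim4-p-11` lead (parts 1–4), `res-dim4-p-5` (part `…SpivakovskyOneVertex`: Lemma 3, denominators, stabilisation),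
`res-dim4-p-10` (the lattice game `PolyhedraGame.WeakWin` and the spine export), `res-dim4-p-14` (positionality)).
Def-free.  Source: M. Spivakovsky, *A solution to Hironaka's polyhedra game*, Arithmetic and Geometry II (Progr.
Math. 36, 1983) 419–432, end of §III (pp. 431–432) [cite: Spivakovsky1983, §III (Proposition; termination pp. 431–432)].

## The theorem (`no_strategy_play`)
There is no infinite sequence of positions `P 0, P 1, …` on an index set `I`, all good, with bounded
denominators and `d(P l) ≥ 1` (= «player A has not yet won», in either the printed weak or the typed strict
reading), in which each `P (l+1)` is obtained from `P l` by Spivakovsky's strategy `Γ_l = strat I (P l)` and SOME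
answer `ι l ∈ Γ_l` of player B.  Hence the (positional, permissible — parts 1–2) strategy wins Hironaka's original
polyhedra game from every position in finitely many moves, whatever B does.

## The proof (the source's last page, restructured as an induction on `#I`)
The source shows that the vector `δ(Δ)` drops lexicographically at every move and then argues (p. 432) that a
co-ordinate of `δ` with bounded denominators cannot drop for ever, treating the tail of the play «as the game on
the set `Δ_k`».  We run exactly this argument as an INDUCTION ON `#I`: (A) once `d(G̃) = 0` the position is a
single vertex and `d(G) ∈ (1/N)ℤ` drops by Lemma 3 at every move — impossible below the floor `d ≥ 1`;
(B) otherwise `d(G̃) ∈ (1/N)ℤ_{≥0}` never increases (Lemma 2 (a)), so it is eventually constant; from then on B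
never answers inside `S` and `S` only grows (Lemma 2 (b)), so `S` is eventually constant; from then on the derived
generator sets `G₁` perform a strategy play on `I₁ = I ∖ S`, `#I₁ < #I` (Lemma 2 (c)) — contradicting the
induction hypothesis.

[OURS · counted 0 · AI work weaker than expert review] Kernel transcription of a 1983 combinatorial theorem used by
OUR frame's spine game (F4-S); NOTHING here is a theorem about resolution of singularities in dimension ≥ 4 /
characteristic `p`. bears_on: LADDER-RESOLUTION:D157-DOOR2 (res-dim4-pi · PR-9c). Supports
stmt-ResolutionOfSingularities-16155 (helper).
-/

set_option linter.dupNamespace false -- mandated namespace of this single-conjunct summit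

open Finset
open scoped BigOperators

namespace Summit.ResolutionOfSingularities.ResolutionOfSingularities.Theorems.PIDim4

namespace Spivakovsky

variable {σ : Type} [Fintype σ] [DecidableEq σ]

section Termination

variable {I : Finset σ}

/-! ## §1 Case (A): the one-vertex regime cannot last for ever -/

/-- Once `d(G̃) = 0` along a strategy play, it stays `0`. [cite: Spivakovsky1983, §III Lemma 3] -/
theorem dt_eq_zero_of_le {P : ℕ → Pos σ} {ι : ℕ → σ} (hgood : ∀ l, Good I (P l)) (hd : ∀ l, 1 ≤ dG I (P l))
    (hι : ∀ l, ι l ∈ strat I (P l)) (hstep : ∀ l, P (l + 1) = (P l).image (move (strat I (P l)) (ι l)))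
    {l₀ : ℕ} (h₀ : dt I (P l₀) = 0) : ∀ m, dt I (P (l₀ + m)) = 0 := by
  intro m
  induction m with
  | zero => simpa using h₀
  | succ m ih =>
    rw [← add_assoc, hstep]
    exact dt_image_move_eq_zero (hgood _) (hd _) ih (hι _)

/-- **Case (A)**: a strategy play with bounded denominators and `d ≥ 1` never reaches `d(G̃) = 0` — after that
`N·d(G)` would be a strictly decreasing sequence of integers `≥ N`. [cite: Spivakovsky1983, §III Lemma 3, p. 432] -/
theorem no_play_of_dt_eq_zero {N : ℕ} (hN : 0 < N) {P : ℕ → Pos σ} {ι : ℕ → σ}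
    (hgood : ∀ l, Good I (P l)) (hden : ∀ l, Den N (P l)) (hd : ∀ l, 1 ≤ dG I (P l))
    (hι : ∀ l, ι l ∈ strat I (P l)) (hstep : ∀ l, P (l + 1) = (P l).image (move (strat I (P l)) (ι l)))
    {l₀ : ℕ} (h₀ : dt I (P l₀) = 0) : False := by
  have hdt := dt_eq_zero_of_le hgood hd hι hstep h₀
  -- integral values `z m = N · d(P (l₀ + m))`
  have hz : ∀ m, ∃ z : ℤ, dG I (P (l₀ + m)) * N = z := fun m => exists_int_dG (hden _) (hgood _).1 I
  choose z hz using hz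
  have hdrop : ∀ m, z (m + 1) < z m := by
    intro m
    have hlt : dG I (P (l₀ + m + 1)) < dG I (P (l₀ + m)) := by
      rw [hstep]
      exact dG_image_move_lt (hgood _) (hd _) (hdt m) (hι _)
    have hNq : (0 : ℚ) < N := by exact_mod_cast hN
    have : (z (m + 1) : ℚ) < z m := by
      rw [← hz m, ← hz (m + 1), ← add_assoc]
      exact mul_lt_mul_of_pos_right hlt hNq
    exact_mod_cast this
  have hfloor : ∀ m, (N : ℤ) ≤ z m := by
    intro m
    have : (N : ℚ) ≤ z m := by
      rw [← hz m]
      have h1 := hd (l₀ + m)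
      have hNq : (0 : ℚ) ≤ N := by exact_mod_cast hN.le
      nlinarith
    exact_mod_cast this
  have hbound : ∀ m, z m ≤ z 0 - m := by
    intro m
    induction m with
    | zero => simp
    | succ m ih => have := hdrop m; push_cast; omega
  have h1 := hbound ((z 0).toNat + 1)
  have h2 := hfloor ((z 0).toNat + 1)
  push_cast at h1
  omega

/-! ## §2 The theorem: no infinite strategy play (induction on `#I`) -/

/-- **Spivakovsky's theorem, generator form.**  For every index set `I`: there is NO infinite sequence of good
positions on `I` with denominators bounded by some `N > 0` and `d ≥ 1` throughout, driven by the strategy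
`strat` against arbitrary answers of player B.  [cite: Spivakovsky1983, Theorem (§I) and §III pp. 431–432] -/
theorem no_strategy_play : ∀ (n : ℕ) (I : Finset σ), I.card ≤ n → ∀ (N : ℕ), 0 < N →
    ∀ (P : ℕ → Pos σ) (ι : ℕ → σ), (∀ l, Good I (P l)) → (∀ l, Den N (P l)) → (∀ l, 1 ≤ dG I (P l)) →
      (∀ l, ι l ∈ strat I (P l)) → (∀ l, P (l + 1) = (P l).image (move (strat I (P l)) (ι l))) → False := by
  intro n
  induction n with
  | zero =>
    intro I hI N _ P ι hgood _ hd _ _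
    have hI0 : I = ∅ := Finset.card_eq_zero.mp (Nat.le_zero.mp hI)
    subst hI0
    obtain ⟨g, hg, hgd⟩ := exists_dG_eq (∅ : Finset σ) (hgood 0).1
    rw [Finset.sum_empty] at hgd
    have := hd 0
    linarith
  | succ n ih =>
    intro I hI N hN P ι hgood hden hd hι hstep
    -- Case (A): the one-vertex regime is reached
    by_cases hA : ∃ l₀, dt I (P l₀) = 0
    · obtain ⟨l₀, h₀⟩ := hA
      exact no_play_of_dt_eq_zero hN hgood hden hd hι hstep h₀
    push Not at hA
    -- Case (B): `d(G̃) ≠ 0` for ever.  (B1) `N · d(G̃)` is an antitone sequence of naturals, hence stabilises.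
    have hmono : ∀ l, dt I (P (l + 1)) ≤ dt I (P l) := fun l => by
      rw [hstep]; exact dt_image_move_le (hgood l) (hd l) (hA l) (hι l)
    have hnat : ∀ l, ∃ m : ℕ, dt I (P l) * N = m := fun l => exists_nat_dt (hgood l) (hden l)
    choose f hf using hnat
    have hNq : (0 : ℚ) < N := by exact_mod_cast hN
    have hfmono : ∀ l, f (l + 1) ≤ f l := fun l => by
      have : (f (l + 1) : ℚ) ≤ f l := by
        rw [← hf, ← hf]; exact mul_le_mul_of_nonneg_right (hmono l) hNq.le
      exact_mod_cast this
    obtain ⟨l₀, hl₀⟩ := exists_stable_of_antitone hfmono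
    have hconst : ∀ l, l₀ ≤ l → dt I (P l) = dt I (P l₀) := fun l hl => by
      have h1 : dt I (P l) * N = dt I (P l₀) * N := by rw [hf, hf, hl₀ l hl]
      exact mul_right_cancel₀ hNq.ne' h1
    have heq : ∀ l, l₀ ≤ l → dt I ((P l).image (move (strat I (P l)) (ι l))) = dt I (P l) := fun l hl => by
      rw [← hstep, hconst l hl, hconst (l + 1) (by omega)]
    -- (B2) from `l₀` on, `S` is a non-decreasing chain inside `I`, hence stabilises at `l₁ = l₀ + m₀`
    have hchain : ∀ m, Sset I (P (l₀ + m)) ⊆ Sset I (P (l₀ + m + 1)) := fun m => by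
      rw [hstep]
      exact Sset_subset_Sset_image_move (hgood _) (hd _) (hA _) (hι _) (heq _ (by omega))
    obtain ⟨m₀, hm₀⟩ := exists_stable_of_chain (T := fun m => Sset I (P (l₀ + m)))
      (fun m => by simpa [add_assoc] using hchain m) (fun _ => Sset_subset)
    set l₁ := l₀ + m₀ with hl₁
    set S := Sset I (P l₁) with hSdef
    have hS : ∀ m, Sset I (P (l₁ + m)) = S := fun m => by
      have := hm₀ (m₀ + m) (by omega)
      simpa [hl₁, add_assoc] using this
    have hS' : ∀ m, Sset I ((P (l₁ + m)).image (move (strat I (P (l₁ + m))) (ι (l₁ + m)))) =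
        Sset I (P (l₁ + m)) := fun m => by
      rw [← hstep, hS m, show l₁ + m + 1 = l₁ + (m + 1) by omega, hS (m + 1)]
    have heq₁ : ∀ m, dt I ((P (l₁ + m)).image (move (strat I (P (l₁ + m))) (ι (l₁ + m)))) =
        dt I (P (l₁ + m)) := fun m => heq _ (by omega)
    -- (B3) from `l₁` on the derived sets are non-empty and perform a strategy play on `I₁ = I ∖ S`
    have hne : ∀ m, (derive I (P (l₁ + m))).Nonempty := fun m => by
      by_contra hempty
      rw [Finset.not_nonempty_iff_eq_empty] at hempty
      have h1 := hι (l₁ + m)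
      rw [strat_eq_Sset (hgood _) (hA _) hempty] at h1
      exact not_mem_Sset_of_dt_eq (hgood _) (hd _) (hA _) (hι _) (heq₁ m) h1
    set Q : ℕ → Pos σ := fun m => derive I (P (l₁ + m)) with hQ
    set κ : ℕ → σ := fun m => ι (l₁ + m) with hκ
    have hI1 : ∀ m, I1 I (P (l₁ + m)) = I \ S := fun m => by rw [I1, hS m]
    have hQstep : ∀ m, Q (m + 1) = (Q m).image (move (strat (I \ S) (Q m)) (κ m)) := fun m => by
      simp only [hQ, hκ]
      rw [show l₁ + (m + 1) = l₁ + m + 1 by omega, hstep, ← hI1 m]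
      exact derive_image_move (hgood _) (hd _) (hA _) (hι _) (heq₁ m) (hS' m) (hne m)
    have hκmem : ∀ m, κ m ∈ strat (I \ S) (Q m) := fun m => by
      simp only [hQ, hκ]
      rw [← hI1 m]
      have hgood' : Good I ((P (l₁ + m)).image (move (strat I (P (l₁ + m))) (ι (l₁ + m)))) := by
        rw [← hstep, show l₁ + m + 1 = l₁ + (m + 1) by omega]; exact hgood _
      exact (strat_image_move (hgood _) (hd _) (hA _) (hι _) hgood' (heq₁ m) (hS' m) (hne m)).2
    have hQgood : ∀ m, Good (I \ S) (Q m) := fun m => by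
      simp only [hQ]; rw [← hI1 m]; exact good_derive (hgood _) (hne m)
    have hQd : ∀ m, 1 ≤ dG (I \ S) (Q m) := fun m => by
      simp only [hQ]; rw [← hI1 m]; exact one_le_dG_derive (hgood _) (hd _) (hA _) (hne m)
    -- denominators of the derived play: pick one for `Q 0`, the moves preserve it
    obtain ⟨N', hN', hden'0⟩ := exists_den (Q 0)
    have hden' : ∀ m, Den N' (Q m) := fun m => by
      induction m with
      | zero => exact hden'0
      | succ m ihm => rw [hQstep]; exact den_image_move ihm _ _
    -- `#(I ∖ S) < #I ≤ n + 1`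
    have hcard : (I \ S).card ≤ n := by
      have hlt : (I1 I (P l₁)).card < I.card := card_I1_lt (hgood _) (hA _)
      have h0 : I1 I (P l₁) = I \ S := by simpa using hI1 0
      rw [h0] at hlt
      omega
    exact ih (I \ S) hcard N' hN' Q κ hQgood hden' hQd hκmem hQstep

/-- **Spivakovsky's theorem, play form at `I`** (the bound `n` instantiated). [cite: Spivakovsky1983, Theorem (§I)] -/
theorem no_strategy_play' (I : Finset σ) {N : ℕ} (hN : 0 < N) (P : ℕ → Pos σ) (ι : ℕ → σ)
    (hgood : ∀ l, Good I (P l)) (hden : ∀ l, Den N (P l)) (hd : ∀ l, 1 ≤ dG I (P l))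
    (hι : ∀ l, ι l ∈ strat I (P l)) (hstep : ∀ l, P (l + 1) = (P l).image (move (strat I (P l)) (ι l))) :
    False :=
  no_strategy_play I.card I le_rfl N hN P ι hgood hden hd hι hstep

end Termination

end Spivakovsky

end Summit.ResolutionOfSingularities.ResolutionOfSingularities.Theorems.PIDim4
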